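import Summits.ResolutionOfSingularities.ResolutionOfSingularities.Theorems.FrobeniusLadderFInjectiveMacaulayficationOmegaFloorFactorsThroughClassModel
import Summits.ResolutionOfSingularities.ResolutionOfSingularities.Theorems.FrobeniusLadderFInjectiveMacaulayficationB9NewtonKFan
import Summits.ResolutionOfSingularities.ResolutionOfSingularities.Theorems.FrobeniusLadderFInjectiveMacaulayficationB9Specimen
import Literature.AlgebraicGeometry.Resolution.AffineBlowupIntegral
import HarnessLib

/-!
# BED Ω, GLOBAL PATCH (g-b), F4 (a) for Ω₁ ON B9: the floor `S′_{Ω₁} := Bl_{I′}(X_{B9})`, `I′ = L³ + g·L²` (`L = 𝔪·K` the class centre, `g = x·u² − y³`) is ONE affine blow-up, and factors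
# through the class model `X̃ = Bl_L(X_{B9})` as a blowing up along `𝒥 = (L + (g))·𝒪_{X̃}` whose support lies OVER THE VERTEX — the `(π, 𝒥, h𝒥fib)` of ✓p703009 `admissible_of_composite`
# (crux `FInjectiveMacaulayfication` stmt-ResolutionOfSingularities-15315, chain w45a; R23.23 (1) kernel file F4; idea-1 g30 `Q17-r0.md` §Ω1/§Ω2 (Ω₁ := I′(g,1), g = x·u² − y³); seat
# res-L1-w45a-stub-3 g13)

[OURS · L1 W4.5a] Support file (`--supports stmt-ResolutionOfSingularities-15315 --as helper`); theorems only; no named fact; NOT a statement of any manuscript; nothing of the crux is proved;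
the census letter «CURED» for Ω₁ is NOT claimed (F5–F7 of the list remain). AI-written (AI review is weaker than expert review).
* `zeroLocus_classCentre_subset_vertex` — `V(L) = {v}` on `X_{B9}` (`L ∋ x_j^{N_j}` by ✓ `B9NewtonKFan.hprimAJ`, the vertex is closed);
  ★★ `omega1_floor_fac_classModel` — the factorisation with `∀ s ∈ supp 𝒥, π_L(s) = v`;
  §F4 (b): `classCentre_ne_bot`, ★ `isIntegral_omega1_floor` (`S′` integral, `3 ≠ 0` in `k`).
[cite: StacksProject, Tag 080A; GortzWedhorn2020, Prop. 13.92]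
-/

set_option linter.dupNamespace false

noncomputable section

open AlgebraicGeometry CategoryTheory Literature.AlgebraicGeometry.Resolution MvPolynomial

namespace Summit.ResolutionOfSingularities.ResolutionOfSingularities.Theorems.FInjectiveMacaulayfication.OmegaOneFloorFactorsB9

open Summit.ResolutionOfSingularities.ResolutionOfSingularities.Theorems.FInjectiveMacaulayfication
open FanCheckKit B9NewtonKFan OmegaFloorFactorsThroughClassModel

variable (k : Type) [Field k]

/-- **`V(L) ⊆ {v}` for the class centre `L = (monomials of genSet 5 AL2)` on `X_{B9}`**: every prime containing `L` contains a power of each variable, hence every variable, hence the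
(maximal) vertex ideal. [bookkeeping over ✓ `B9NewtonKFan.hprimAJ` and ✓ `B9Specimen.isClosed_vertex`] -/
theorem zeroLocus_classCentre_subset_vertex (f : MvPolynomial (Fin 5) k) (hf : f = X 4 ^ 2 + X 0 ^ 9 + X 1 ^ 9 + X 2 ^ 9 + X 3 ^ 9)
    (v : Spec (.of (MvPolynomial (Fin 5) k ⧸ Ideal.span {f}))) (hv : v.asIdeal = Ideal.span (Set.range fun j : Fin 5 => Ideal.Quotient.mk (Ideal.span {f}) (X j))) :
    PrimeSpectrum.zeroLocus ((Ideal.span ((fun e : Fin 5 →₀ ℕ => Ideal.Quotient.mk (Ideal.span {f}) (monomial e (1 : k))) '' (genSet 5 AL2 : Set (Fin 5 →₀ ℕ))) :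
      Ideal (MvPolynomial (Fin 5) k ⧸ Ideal.span {f})) : Set (MvPolynomial (Fin 5) k ⧸ Ideal.span {f})) ⊆ {v} := by
  intro P hP
  rw [PrimeSpectrum.mem_zeroLocus, SetLike.coe_subset_coe] at hP
  have hvmax : v.asIdeal.IsMaximal := (PrimeSpectrum.isClosed_singleton_iff_isMaximal v).1 (B9Specimen.isClosed_vertex k f hf v hv)
  have hle : v.asIdeal ≤ P.asIdeal := by
    rw [hv, Ideal.span_le]
    rintro _ ⟨j, rfl⟩
    obtain ⟨N, hN⟩ := hprimAJ.2.1 j (Finset.mem_univ _)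
    have hmem : Ideal.Quotient.mk (Ideal.span {f}) (X j) ^ N ∈ P.asIdeal := by
      refine hP (Ideal.subset_span ⟨_, Finset.mem_coe.mpr hN, ?_⟩)
      rw [← map_pow, X_pow_eq_monomial]
    exact P.isPrime.mem_of_pow_mem N hmem
  exact PrimeSpectrum.ext (hvmax.eq_of_le P.isPrime.ne_top hle).symm

/-- ★★ **THE Ω₁ FLOOR FACTORS THROUGH THE CLASS MODEL OF B9, WITH FIBRE-SUPPORTED SECOND CENTRE.** Let `X = Spec k[x,y,u,t,z]/(z² + x⁹ + y⁹ + u⁹ + t⁹)`, `L` the class centre (monomials of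
`genSet 5 AL2`, `= 𝔪·K` by ✓ `span_A_eq_floor_mul_K`), `g = x·u² − y³`, `I′ = L³ + (g)·L²` (idea-1ʼs Ω₁ = `I′(g,1)`), `v` the vertex. Then `π_{I′} : Bl_{I′} X → X` factors as `τ ≫ π_L`
with `τ : Bl_{I′} X → X̃ = Bl_L X` a blowing up along `𝒥 = (L + (g))~.comap π_L` and EVERY point of `supp 𝒥` lies over `v` — the data `(π, 𝒥, h𝒥fib)` of ✓p703009
`CompositeFloorAdmissible.admissible_of_composite` for the Ω₁ floor, any field `k`. [OURS · BED Ω (g-b) F4 (a); cite: StacksProject, Tag 080A] -/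
theorem omega1_floor_fac_classModel (f : MvPolynomial (Fin 5) k) (hf : f = X 4 ^ 2 + X 0 ^ 9 + X 1 ^ 9 + X 2 ^ 9 + X 3 ^ 9)
    (v : Spec (.of (MvPolynomial (Fin 5) k ⧸ Ideal.span {f}))) (hv : v.asIdeal = Ideal.span (Set.range fun j : Fin 5 => Ideal.Quotient.mk (Ideal.span {f}) (X j))) :
    let L : Ideal (MvPolynomial (Fin 5) k ⧸ Ideal.span {f}) := Ideal.span ((fun e : Fin 5 →₀ ℕ => Ideal.Quotient.mk (Ideal.span {f}) (monomial e (1 : k))) '' (genSet 5 AL2 : Set (Fin 5 →₀ ℕ)))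
    let g : MvPolynomial (Fin 5) k ⧸ Ideal.span {f} := Ideal.Quotient.mk (Ideal.span {f}) (X 0 * X 2 ^ 2 - X 1 ^ 3)
    ∃ τ : affineBlowup (L ^ 3 + Ideal.span {g} * L ^ 2) ⟶ affineBlowup L,
      IsBlowup τ ((affineBlowup.idealSheaf (L + Ideal.span {g})).comap (affineBlowup.π L)) ∧
      τ ≫ affineBlowup.π L = affineBlowup.π (L ^ 3 + Ideal.span {g} * L ^ 2) ∧
      ∀ s ∈ (((affineBlowup.idealSheaf (L + Ideal.span {g})).comap (affineBlowup.π L)).support : Set (affineBlowup L)), (affineBlowup.π L).base s = v := by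
  intro L g
  obtain ⟨τ, hτ, hfac, hsupp⟩ := exists_floor_fac_classModel L g
  exact ⟨τ, hτ, hfac, fun s hs => zeroLocus_classCentre_subset_vertex k f hf v hv (hsupp hs)⟩


/-! ## F4 (b): the Ω₁ floor is an INTEGRAL scheme -/

/-- The class centre `L` of B9 is a nonzero ideal (it contains `x₀^N`). [plumbing] -/
theorem classCentre_ne_bot (h3 : (3 : k) ≠ 0) (f : MvPolynomial (Fin 5) k) (hf : f = X 4 ^ 2 + X 0 ^ 9 + X 1 ^ 9 + X 2 ^ 9 + X 3 ^ 9) :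
    (Ideal.span ((fun e : Fin 5 →₀ ℕ => Ideal.Quotient.mk (Ideal.span {f}) (monomial e (1 : k))) '' (genSet 5 AL2 : Set (Fin 5 →₀ ℕ))) :
      Ideal (MvPolynomial (Fin 5) k ⧸ Ideal.span {f})) ≠ ⊥ := by
  have hprime := B9Specimen.prime_f k h3 f hf
  haveI : (Ideal.span {f}).IsPrime := (Ideal.span_singleton_prime hprime.ne_zero).mpr hprime
  haveI : IsDomain (MvPolynomial (Fin 5) k ⧸ Ideal.span {f}) := Ideal.Quotient.isDomain _
  obtain ⟨N, hN⟩ := hprimAJ.2.1 0 (Finset.mem_univ _)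
  intro h0
  have hmem : Ideal.Quotient.mk (Ideal.span {f}) (monomial (Finsupp.single 0 N) (1 : k)) ∈
      Ideal.span ((fun e : Fin 5 →₀ ℕ => Ideal.Quotient.mk (Ideal.span {f}) (monomial e (1 : k))) '' (genSet 5 AL2 : Set (Fin 5 →₀ ℕ))) :=
    Ideal.subset_span ⟨_, Finset.mem_coe.mpr hN, rfl⟩
  rw [h0, Ideal.mem_bot, ← X_pow_eq_monomial, map_pow] at hmem
  exact pow_ne_zero N (B9Specimen.mk_X_ne_zero k h3 f hf 0) hmem

/-- ★ **THE Ω₁ FLOOR `S′ = Bl_{L³ + (g)L²}(X_{B9})` IS AN INTEGRAL SCHEME** (`3 ≠ 0` in `k`, so `X_{B9}` is integral ✓ `B9Specimen.prime_f`; the centre is nonzero; ✓ `affineBlowup.isIntegral`) —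
the `[IsIntegral S′]` instance that ✓p703009 `admissible_of_composite` asks for. [OURS · BED Ω (g-b) F4 (b); cite: GortzWedhorn2020, Prop. 13.92] -/
theorem isIntegral_omega1_floor (h3 : (3 : k) ≠ 0) (f : MvPolynomial (Fin 5) k) (hf : f = X 4 ^ 2 + X 0 ^ 9 + X 1 ^ 9 + X 2 ^ 9 + X 3 ^ 9) :
    let L : Ideal (MvPolynomial (Fin 5) k ⧸ Ideal.span {f}) := Ideal.span ((fun e : Fin 5 →₀ ℕ => Ideal.Quotient.mk (Ideal.span {f}) (monomial e (1 : k))) '' (genSet 5 AL2 : Set (Fin 5 →₀ ℕ)))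
    let g : MvPolynomial (Fin 5) k ⧸ Ideal.span {f} := Ideal.Quotient.mk (Ideal.span {f}) (X 0 * X 2 ^ 2 - X 1 ^ 3)
    IsIntegral (affineBlowup (L ^ 3 + Ideal.span {g} * L ^ 2)) := by
  intro L g
  have hprime := B9Specimen.prime_f k h3 f hf
  haveI : (Ideal.span {f}).IsPrime := (Ideal.span_singleton_prime hprime.ne_zero).mpr hprime
  haveI : IsDomain (MvPolynomial (Fin 5) k ⧸ Ideal.span {f}) := Ideal.Quotient.isDomain _
  refine affineBlowup.isIntegral fun h0 => ?_
  obtain ⟨N, hN⟩ := hprimAJ.2.1 0 (Finset.mem_univ _)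
  have hmem : Ideal.Quotient.mk (Ideal.span {f}) (monomial (Finsupp.single 0 N) (1 : k)) ∈ L := Ideal.subset_span ⟨_, Finset.mem_coe.mpr hN, rfl⟩
  have hmem3 : Ideal.Quotient.mk (Ideal.span {f}) (monomial (Finsupp.single 0 N) (1 : k)) ^ 3 ∈ L ^ 3 + Ideal.span {g} * L ^ 2 :=
    Ideal.mem_sup_left (Ideal.pow_mem_pow hmem 3)
  rw [h0, Ideal.mem_bot, ← X_pow_eq_monomial, map_pow, ← pow_mul] at hmem3
  exact pow_ne_zero _ (B9Specimen.mk_X_ne_zero k h3 f hf 0) hmem3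

end Summit.ResolutionOfSingularities.ResolutionOfSingularities.Theorems.FInjectiveMacaulayfication.OmegaOneFloorFactorsB9

end
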